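/-
Copyright (c) 2026. All rights reserved.
Released under Apache 2.0 license as described in the file LICENSE.
-/
import Summits.AtomisticToContinuum.Crystallization.Theorems.OverbindingBudgetAffineFarStraighteningCompat
import Summits.AtomisticToContinuum.Crystallization.Theorems.OverbindingBudgetAffineFarStraighteningTwoStepCert

/-!
# Overbinding budget — R_aff′ brick TWOSTEP: the snapped reading of an adjacent site is complete below `√(8/3)`

Slot Z of `stmt-AtomisticToContinuum-31280`, leaf `…FarSmoothSplit.AffineChartStraightening'` (R_aff′), radial development (g59
memo §3), assembly step (e) EXHAUSTIVENESS: **TWOSTEP** (`snapTwoStep_holds`) — for an isometric full snap `U` (`IsSnap P P' e f U`),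
every `u' ∈ insert 0 P'` with `dist u' f ^ 2 < 8/3` has `e + U u' ∈ insert 0 P`.  Since `‖e + U u'‖ = ‖u' − f‖` (`U f = −e`), this
says: a site two adjacency steps away that lands within `√(8/3)` of `j` in exact coordinates IS one of `j`'s own 18 pattern sites —
with COMPAT this makes the developed structure exhaustive within `3/2·a₀` (`1.5/(1 − (√6/2)θ) = 1.5774 < 1.633`).
Proof: the integer certificate `…StraighteningTwoStepCert` (48 kernel `decide`s) + the COMPAT transport (the frame decomposition
`8N(u − e) = U z(u)` and `z(u) = 8N u'` give `u − e = U u'`).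
-/

namespace Summit.AtomisticToContinuum.Crystallization.Theorems.OverbindingBudgetAffineFarSmoothSplit

open scoped BigOperators RealInnerProductSpace
open Literature.Geometry.DiscreteGeometry (fccTwoShellPattern hcpTwoShellPattern scaledPattern intVec intVec_apply intVec_sub
  norm_intVec sqNormInt fccInt hcpInt fccSecondShellInt hcpSecondShellInt sqNormInt_fccInt sqNormInt_hcpInt)

/-! ## §1  The brick -/

/-- **TWOSTEP · COMPLETENESS OF THE SNAPPED READING BELOW `√(8/3)`.** [this file; g59 memo §3 (e)] -/
def SnapTwoStep : Prop :=
  ∀ (P P' : Finset (EuclideanSpace ℝ (Fin 3))), (P = fccTwoShellPattern ∨ P = hcpTwoShellPattern) →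
    (P' = fccTwoShellPattern ∨ P' = hcpTwoShellPattern) → ∀ e ∈ P, ‖e‖ = 1 → ∀ f ∈ P', ‖f‖ = 1 →
      ∀ (U : EuclideanSpace ℝ (Fin 3) →ₗᵢ[ℝ] EuclideanSpace ℝ (Fin 3)), IsSnap P P' e f U.toLinearMap →
        ∀ u' ∈ insert (0 : EuclideanSpace ℝ (Fin 3)) P', dist u' f ^ 2 < 8 / 3 →
          e + U u' ∈ insert (0 : EuclideanSpace ℝ (Fin 3)) P

/-! ## §2  Transport and the proof -/

/-- **TWOSTEP on the integer models.** [this file] -/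
theorem snapTwoStep_scaled {S S₂ S' S₂' : Finset (Fin 3 → ℤ)} {N N' : ℕ} (hN : N ≠ 0) (hN' : N' ≠ 0)
    (hSnorm' : ∀ z ∈ S', sqNormInt z = N')
    (hfirst : ∀ z ∈ S ∪ S₂, sqNormInt z = N → z ∈ S) (hfirst' : ∀ z ∈ S' ∪ S₂', sqNormInt z = N' → z ∈ S')
    (hcert : ∀ zf ∈ S', SnapTwoStepAt S S₂ N S' S₂' N' zf)
    {e f : EuclideanSpace ℝ (Fin 3)} (he : e ∈ scaledPattern (S ∪ S₂) N) (he1 : ‖e‖ = 1)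
    (hf : f ∈ scaledPattern (S' ∪ S₂') N') (hf1 : ‖f‖ = 1)
    (U : EuclideanSpace ℝ (Fin 3) →ₗᵢ[ℝ] EuclideanSpace ℝ (Fin 3))
    (hU : IsSnap (scaledPattern (S ∪ S₂) N) (scaledPattern (S' ∪ S₂') N') e f U.toLinearMap)
    {u' : EuclideanSpace ℝ (Fin 3)} (hu' : u' ∈ insert (0 : EuclideanSpace ℝ (Fin 3)) (scaledPattern (S' ∪ S₂') N'))
    (hlt : dist u' f ^ 2 < 8 / 3) :
    e + U u' ∈ insert (0 : EuclideanSpace ℝ (Fin 3)) (scaledPattern (S ∪ S₂) N) := by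
  obtain ⟨hUf, hUsh⟩ := hU
  simp only [LinearIsometry.coe_toLinearMap] at hUf hUsh
  have hNpos : (0 : ℝ) < (N : ℝ) := by exact_mod_cast Nat.pos_of_ne_zero hN
  have hN'pos : (0 : ℝ) < (N' : ℝ) := by exact_mod_cast Nat.pos_of_ne_zero hN'
  have hN0 : (N : ℝ) ≠ 0 := hNpos.ne'
  have hN'0 : (N' : ℝ) ≠ 0 := hN'pos.ne'
  have hsN' : ((Real.sqrt N')⁻¹) ^ 2 = (N' : ℝ)⁻¹ := by rw [inv_pow, Real.sq_sqrt hN'pos.le]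
  obtain ⟨ze, hze, rfl⟩ := Finset.mem_image.1 he
  have hzeS : ze ∈ S := hfirst ze hze (sqNormInt_eq_of_norm_scaled_eq_one hN he1)
  obtain ⟨zf, hzf, rfl⟩ := Finset.mem_image.1 hf
  have hzfS : zf ∈ S' := hfirst' zf hzf (sqNormInt_eq_of_norm_scaled_eq_one hN' hf1)
  obtain ⟨zu', hzu', rfl⟩ := exists_int_of_mem_insert hu'
  obtain ⟨c₁, hc₁S, c₂, hc₂S, hc₁f, hc₂f, -, hcore⟩ := hcert zf hzfS
  -- the common shell of `f`, realised
  have hsh : ∀ c ∈ S', sqNormInt (c - zf) = N' →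
      InCommonShell (scaledPattern (S' ∪ S₂') N') ((Real.sqrt N')⁻¹ • intVec zf) ((Real.sqrt N')⁻¹ • intVec c) :=
    fun c hc hcf => ⟨Finset.mem_image_of_mem _ (Finset.mem_union_left _ hc), norm_scaled_eq_one hN' (hSnorm' c hc),
      by rw [← dist_eq_norm]; exact dist_scaled_eq_one hN' hcf⟩
  have hhalf : ∀ c, InCommonShell (scaledPattern (S' ∪ S₂') N') ((Real.sqrt N')⁻¹ • intVec zf) c →
      ⟪c, (Real.sqrt N')⁻¹ • intVec zf⟫ = 1 / 2 := fun c hc => real_inner_eq_half hc.2.1 hf1 hc.2.2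
  have hC₁ := hsh c₁ hc₁S hc₁f
  have hC₂ := hsh c₂ hc₂S hc₂f
  obtain ⟨zd₁, hzd₁S, hd₁, hd₁e⟩ := exists_int_of_inCommonShell hN hfirst (hUsh _ hC₁)
  obtain ⟨zd₂, hzd₂S, hd₂, hd₂e⟩ := exists_int_of_inCommonShell hN hfirst (hUsh _ hC₂)
  -- Gram match and the full-snap side condition
  have hgram : (N' : ℤ) * dotInt zd₁ zd₂ = N * dotInt c₁ c₂ := by
    apply int_eq_of_inner_scaled_eq hN hN'
    rw [← hd₁, ← hd₂, inner_snapImage U hUf he1 (hhalf _ hC₁) (hhalf _ hC₂)]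
  have hall : ∀ c' ∈ S', sqNormInt (c' - zf) = N' → ∃ d ∈ S, sqNormInt (d - ze) = N ∧
      (N' : ℤ) * dotInt d zd₁ = N * dotInt c' c₁ ∧ (N' : ℤ) * dotInt d zd₂ = N * dotInt c' c₂ := by
    intro c' hc'S hc'f
    have hC' := hsh c' hc'S hc'f
    obtain ⟨zd, hzdS, hd, hde⟩ := exists_int_of_inCommonShell hN hfirst (hUsh _ hC')
    refine ⟨zd, hzdS, hde, ?_, ?_⟩
    · apply int_eq_of_inner_scaled_eq hN hN'
      rw [← hd, ← hd₁, inner_snapImage U hUf he1 (hhalf _ hC') (hhalf _ hC₁)]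
    · apply int_eq_of_inner_scaled_eq hN hN'
      rw [← hd, ← hd₂, inner_snapImage U hUf he1 (hhalf _ hC') (hhalf _ hC₂)]
  -- the integer distance hypothesis
  have hlt' : 3 * sqNormInt (zu' - zf) < 8 * (N' : ℤ) := by
    have h1 : dist ((Real.sqrt N')⁻¹ • intVec zu') ((Real.sqrt N')⁻¹ • intVec zf) ^ 2 = (sqNormInt (zu' - zf) : ℝ) / N' := by
      rw [dist_scaled_intVec, mul_pow, Real.sq_sqrt (show (0 : ℝ) ≤ (sqNormInt _ : ℝ) by unfold sqNormInt; push_cast; positivity), hsN', div_eq_inv_mul]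
    rw [h1, div_lt_iff₀ hN'pos] at hlt
    have h2 : (3 : ℝ) * (sqNormInt (zu' - zf) : ℝ) < 8 * (N' : ℝ) := by linarith
    exact_mod_cast h2
  obtain ⟨zu, hzu, hdec, hzz⟩ := hcore ze hzeS zd₁ hzd₁S zd₂ hzd₂S hd₁e hd₂e hgram hall zu' hzu' hlt'
  -- the decomposition, realised: `8N (u − e) = U ẑ`, and `ẑ = 8N u'`
  have hUc₁ : U ((Real.sqrt N')⁻¹ • intVec c₁) = (Real.sqrt N)⁻¹ • intVec zd₁ - (Real.sqrt N)⁻¹ • intVec ze := by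
    rw [← hd₁, add_sub_cancel_right]
  have hUc₂ : U ((Real.sqrt N')⁻¹ • intVec c₂) = (Real.sqrt N)⁻¹ • intVec zd₂ - (Real.sqrt N)⁻¹ • intVec ze := by
    rw [← hd₂, add_sub_cancel_right]
  have hdecR : (8 * (N : ℝ)) • ((Real.sqrt N)⁻¹ • intVec zu - (Real.sqrt N)⁻¹ • intVec ze) =
      (8 * (snapA0 N ze zu : ℝ)) • ((Real.sqrt N)⁻¹ • intVec ze) +
        (snapK N ze zd₁ zd₂ zu : ℝ) • ((2 : ℝ) • ((Real.sqrt N)⁻¹ • intVec zd₁) - (Real.sqrt N)⁻¹ • intVec ze) +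
        (snapK N ze zd₂ zd₁ zu : ℝ) • ((2 : ℝ) • ((Real.sqrt N)⁻¹ • intVec zd₂) - (Real.sqrt N)⁻¹ • intVec ze) := by
    ext i
    have hi : ((8 * (N : ℤ) * (zu i - ze i) : ℤ) : ℝ) = ((8 * snapA0 N ze zu * ze i +
        snapK N ze zd₁ zd₂ zu * (2 * zd₁ i - ze i) + snapK N ze zd₂ zd₁ zu * (2 * zd₂ i - ze i) : ℤ) : ℝ) := by
      exact_mod_cast hdec i
    push_cast at hi
    simp only [PiLp.add_apply, PiLp.sub_apply, PiLp.smul_apply, smul_eq_mul, intVec_apply]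
    linear_combination (Real.sqrt N)⁻¹ * hi
  have hz : (8 * (N : ℝ)) • ((Real.sqrt N')⁻¹ • intVec zu') =
      (-(8 * (snapA0 N ze zu : ℝ))) • ((Real.sqrt N')⁻¹ • intVec zf) +
        (snapK N ze zd₁ zd₂ zu : ℝ) • ((2 : ℝ) • ((Real.sqrt N')⁻¹ • intVec c₁) - (Real.sqrt N')⁻¹ • intVec zf) +
        (snapK N ze zd₂ zd₁ zu : ℝ) • ((2 : ℝ) • ((Real.sqrt N')⁻¹ • intVec c₂) - (Real.sqrt N')⁻¹ • intVec zf) := by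
    ext i
    have hi : ((8 * (N : ℤ) * zu' i : ℤ) : ℝ) = ((snapZ N ze zd₁ zd₂ zu zf c₁ c₂ i : ℤ) : ℝ) := by exact_mod_cast (hzz i).symm
    simp only [snapZ] at hi
    push_cast at hi
    simp only [PiLp.add_apply, PiLp.sub_apply, PiLp.smul_apply, smul_eq_mul, intVec_apply]
    linear_combination (Real.sqrt N')⁻¹ * hi
  have hUz : U ((8 * (N : ℝ)) • ((Real.sqrt N')⁻¹ • intVec zu')) =
      (8 * (N : ℝ)) • ((Real.sqrt N)⁻¹ • intVec zu - (Real.sqrt N)⁻¹ • intVec ze) := by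
    rw [hdecR, hz]
    simp only [map_add, map_sub, LinearIsometry.map_smul, hUf, hUc₁, hUc₂]
    module
  have h8N : (8 * (N : ℝ)) ≠ 0 := by positivity
  have hUu' : U ((Real.sqrt N')⁻¹ • intVec zu') = (Real.sqrt N)⁻¹ • intVec zu - (Real.sqrt N)⁻¹ • intVec ze := by
    have h := hUz
    rw [LinearIsometry.map_smul] at h
    exact smul_right_injective _ h8N h
  have hmem : (Real.sqrt N)⁻¹ • intVec zu ∈ insert (0 : EuclideanSpace ℝ (Fin 3)) (scaledPattern (S ∪ S₂) N) := by
    rcases Finset.mem_insert.1 hzu with rfl | hzu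
    · rw [show intVec (0 : Fin 3 → ℤ) = 0 from by ext i; simp [intVec], smul_zero]; exact Finset.mem_insert_self _ _
    · exact Finset.mem_insert_of_mem (Finset.mem_image_of_mem _ hzu)
  rw [hUu', add_sub_cancel]
  exact hmem

/-- **TWOSTEP holds.** [this file; g59 memo §3 (e)] -/
theorem snapTwoStep_holds : SnapTwoStep := by
  intro P P' hP hP' e he he1 f hf hf1 U hU u' hu' hlt
  rcases hP with rfl | rfl <;> rcases hP' with rfl | rfl
  · exact snapTwoStep_scaled two_ne_zero two_ne_zero (fun z hz => sqNormInt_fccInt z hz)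
      (by exact_mod_cast mem_fccInt_of_sqNormInt) (by exact_mod_cast mem_fccInt_of_sqNormInt)
      (by exact_mod_cast snapTwoStepAt_fcc_fcc) he he1 hf hf1 U hU hu' hlt
  · exact snapTwoStep_scaled two_ne_zero (by norm_num) (fun z hz => sqNormInt_hcpInt z hz)
      (by exact_mod_cast mem_fccInt_of_sqNormInt) (by exact_mod_cast mem_hcpInt_of_sqNormInt)
      (by exact_mod_cast snapTwoStepAt_fcc_hcp) he he1 hf hf1 U hU hu' hlt
  · exact snapTwoStep_scaled (by norm_num) two_ne_zero (fun z hz => sqNormInt_fccInt z hz)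
      (by exact_mod_cast mem_hcpInt_of_sqNormInt) (by exact_mod_cast mem_fccInt_of_sqNormInt)
      (by exact_mod_cast snapTwoStepAt_hcp_fcc) he he1 hf hf1 U hU hu' hlt
  · exact snapTwoStep_scaled (by norm_num) (by norm_num) (fun z hz => sqNormInt_hcpInt z hz)
      (by exact_mod_cast mem_hcpInt_of_sqNormInt) (by exact_mod_cast mem_hcpInt_of_sqNormInt)
      (by exact_mod_cast snapTwoStepAt_hcp_hcp) he he1 hf hf1 U hU hu' hlt

end Summit.AtomisticToContinuum.Crystallization.Theorems.OverbindingBudgetAffineFarSmoothSplit
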